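import Summits.BirchSwinnertonDyer.BirchSwinnertonDyer.Theorems.AdditiveBranchIMCGenusKolyvaginNonsplitSignFrobenius
import Literature.NumberTheory.EllipticCurves.TateNormalFormUnramifiedComponentsProofs
import HarnessLib

/-!
# Route `AdditiveBranchIMC`, cruxes `GordTwoRankZeroOffCaseOne` (stmt-BirchSwinnertonDyer-19357) ∕ `MultLower` (19359),
# lines `three_field_road` ∕ `tame_roads_mult`, stub `stub_nonsplitFrobeniusSign[M]` (L2):
# THE KODAIRA–NÉRON–TATE SIGN — at a non-split multiplicative place the arithmetic Frobenius acts as `−1`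
# on `E(K_v^nr)/E⁰(K_v^nr)`

Cell `bsd-addord` (run/shared/lean/pub/bsd-addord/), seat `cruxlead-19357-g3` (continuation lead), HELPER
(`--supports stmt-BirchSwinnertonDyer-19357`). This file PROVES, on the non-split normal form, the statement of the last
arithmetic stub of both lines (skeleton v13, `Lines/three_field_road.lean` 3b0d486a3202 ∕ `Lines/tame_roads_mult.lean`
762befcaecca); the sequel `AdditiveBranchIMCGenusKolyvaginNonsplitSignReceptacle` transports it to the receptacle:

* `frobenius_map_add_reducesToNonsingular_of_nonsplitNormalForm` — for the non-split normal form `N` over `𝓞_v`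
  (`a₃ = a₄ = 0`, `a₆ ∈ 𝓂_v`, `b₂ ∈ 𝓞_vˣ`, tangent form `T² + ā₁T − ā₂` without root in `k_v`; tree
  `LocalIndex.exists_smul_nonsplitNormalForm`), an arithmetic Frobenius `F` at the prime `𝔐` of `\bar 𝓞_v` and a
  point `P ∈ N(K̄_v)` fixed by the inertia group `I_𝔐`: `F P + P ∈ E₀` (nonsingular reduction for `|·|_v`).
  Proof. `P = 𝒪`, or `|x(P)|_v > 1`, or `P` integral with nonsingular reduction: then `P ∈ E₀`, so `F P ∈ E₀`
  (`E₀` is stable under isometric `K_v`-automorphisms, tree `reducesToNonsingular_map_iff_of_forall_eq`) and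
  `E₀` is a group. Otherwise `P = (x, y)` is a BAD point with `x, y ∈ 𝒪ⁿʳ` (inertia-fixed ⇒ coordinates in
  `K_v^nr`), `x ∈ 𝔪ⁿʳ`, of `J = N ⊗ 𝒪ⁿʳ`; the Frobenius restricts to an automorphism `σ` of `𝒪ⁿʳ`
  (`exists_ringEquiv_unrIntegers_smul`) fixing the coefficients, the tangent form splits over `𝒪ⁿʳ` with slopes
  `ρ, ρ′` (`exists_slopes_unrIntegers`) which `σ` SWAPS, and no `σ`-fixed element of `𝒪ⁿʳ` is `≡ ρ`: a `σ`-fixed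
  `r` has residue fixed by the `q`-power map of `k(𝒪_w)` (tree `residue_smul_eq_pow_residueCard_of_isArithFrobAt`),
  hence in `k_v` (tree `exists_residueFieldMap_adicCompletionIntegers`), and `r ≡ ρ` would make `r̄` a `k_v`-root of
  the tangent form — excluded by non-splitness. So the coordinate core
  `GenusKolyvagin.NonsplitSign.hasNonsingularReduction_add_conj` (p681179) gives `P + P^σ ∈ J₀(K_v^nr)`, which is
  `P + F P ∈ E₀` in `N(K̄_v)` (`reducesToNonsingular_map_congrEquiv_of_hasNonsingularReduction`).
* (sequel `…NonsplitSignReceptacle`) `frobenius_smul_add_mem_E0Receptacle_of_not_hasSplitMultiplicativeReductionAt` —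
  the RECEPTACLE FORM, literally the registered signature of `stub_nonsplitFrobeniusSign[M]` (transport from the normal
  form of the minimal model along the substitution of the tree's `TateComponent.exists_componentHom_localPoints`).

THEOREMS ONLY; no `sorry`; nothing about BSD is proved here; the cruxes stay OPEN (three stubs remain: residual
[by design], printedFacts [cite-only], tameJointLower [sibling line]).

References: [cite: SilvermanATAEC1994, Cor. IV.9.2 (d), Thm. IV.9.4 Step 2, Ex. 4.23] [cite: SilvermanAEC2009,
Thm. VII.6.1, App. C Thm. 15.2, VII.§2 Prop. 2.1] [cite: McCallumLMS1991, Lemma 4.3 (proof)]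
[cite: NeukirchANT1999, Ch. II §9].

presearch: «Frobenius acts as −1 on the component group Φ at a non-split multiplicative place / F Q + Q ∈ E⁰» →
[corpus: SilvermanATAEC1994 IV.9 Step 2, Cor. 9.2 (d)] statement level (Tate's algorithm), [corpus: SilvermanAEC2009
App. C §15 Thm. 15.2] (table `c_v ∈ {1,2}` non-split); galaxy "non-split multiplicative|component group|Frobenius"
→ textbook pages only; tree: `NonsplitPoints.hasNonsingularReduction_add_of_anisotropic` (RATIONAL points only),
`TateNormalFormUnramifiedComponentsProofs` (SPLIT case: Galois acts trivially). No formal treatment of the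
non-split Galois action found; the coordinate road (core p681179 + this transport) is ours.
-/

noncomputable section

open scoped Classical NNReal
open NumberField IsDedekindDomain Field Polynomial IsLocalRing

universe u

set_option linter.dupNamespace false

namespace Summit.BirchSwinnertonDyer.BirchSwinnertonDyer.Theorems.GenusKolyvagin.NonsplitSign

open Literature.NumberTheory.EllipticCurves Literature.NumberTheory.EllipticCurves.LocalIndex
  Literature.NumberTheory.GaloisRepresentations
  Literature.NumberTheory.GaloisRepresentations.IsNonarchimedeanLocalField
  IsDedekindDomain.HeightOneSpectrum WeierstrassCurve

variable {K : Type u} [Field K] [NumberField K] {v : HeightOneSpectrum (𝓞 K)}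
  {w : Valuation (AlgebraicClosure (v.adicCompletion K)) ℝ≥0}
  (hw : ∀ x, (w x : ℝ) = spectralNorm (v.adicCompletion K) (AlgebraicClosure (v.adicCompletion K)) x)

/-! ## The sign theorem on the non-split normal form -/

include hw in
set_option maxHeartbeats 4000000 in
/-- **Kodaira–Néron–Tate sign at a non-split node: `F P + P ∈ E₀` for every inertia-fixed `P`.** Let `N` be a
Weierstrass equation over `𝓞_v` in non-split normal form (`a₃ = a₄ = 0`, `a₆ ∈ 𝓂_v`, `b₂ ∈ 𝓞_vˣ`, and
`T² + ā₁T − ā₂` without root in the residue field `k_v`), `w = |·|_v` the spectral valuation of `K̄_v`, `𝔐` the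
prime of `\bar 𝓞_v` above `𝓂_v`, `F ∈ Γ_{K_v}` an arithmetic Frobenius at `𝔐`. Then for every point `P` of
`N(K̄_v)` fixed by the inertia group `I_𝔐` (a point of `E(K_v^nr)`), `F P + P` has nonsingular reduction: the
Frobenius acts as `−1` on `E(K_v^nr)/E₀(K_v^nr) ≅ Φ_v(k̄_v) ≅ ℤ/ord_v(Δ)` (Silverman *ATAEC* Cor. IV.9.2 (d) with
Thm. IV.9.4 Step 2 / Ex. 4.23: at a non-split node `k_v`-Frobenius swaps the two tangents, i.e. acts by inversion
on the split torus and by `−1` on the component group). Proof by the coordinate core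
`hasNonsingularReduction_add_conj` over `𝒪ⁿʳ` (bad points) and the Galois stability of `E₀` (good points); see the
module docstring. [cite: SilvermanATAEC1994, Cor. IV.9.2 (d), Thm. IV.9.4 Step 2]
[cite: SilvermanAEC2009, App. C Thm. 15.2] [cite: McCallumLMS1991, Lemma 4.3 (proof)] -/
theorem frobenius_map_add_reducesToNonsingular_of_nonsplitNormalForm {𝔐 : Ideal v.localAbsIntegers}
    (h𝔐 : 𝔐 ∈ v.localPrimesAbove) (N : WeierstrassCurve (v.adicCompletionIntegers K))
    (h3 : N.a₃ = 0) (h4 : N.a₄ = 0) (h6 : N.a₆ ∈ maximalIdeal (v.adicCompletionIntegers K))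
    (hb₂ : IsUnit N.b₂)
    (hani : ∀ τ : ResidueField (v.adicCompletionIntegers K),
      τ ^ 2 + residue (v.adicCompletionIntegers K) N.a₁ * τ - residue (v.adicCompletionIntegers K) N.a₂ ≠ 0)
    {F : absoluteGaloisGroup (v.adicCompletion K)} (hF : IsArithFrobAt (v.adicCompletionIntegers K) F 𝔐)
    (P : ((N.baseChange (v.adicCompletion K)).baseChange (AlgebraicClosure (v.adicCompletion K))).toAffine.Point)
    (hP : ∀ τ ∈ 𝔐.inertia (absoluteGaloisGroup (v.adicCompletion K)),
      Affine.Point.map ((absoluteGaloisGroup.toAlgEquiv _ τ :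
        AlgebraicClosure (v.adicCompletion K) ≃ₐ[v.adicCompletion K] AlgebraicClosure (v.adicCompletion K)) :
        AlgebraicClosure (v.adicCompletion K) →ₐ[v.adicCompletion K] AlgebraicClosure (v.adicCompletion K)) P = P) :
    ReducesToNonsingular w (IsLocalRing.residue w.integer)
      (Affine.Point.map ((absoluteGaloisGroup.toAlgEquiv _ F :
        AlgebraicClosure (v.adicCompletion K) ≃ₐ[v.adicCompletion K] AlgebraicClosure (v.adicCompletion K)) :
        AlgebraicClosure (v.adicCompletion K) →ₐ[v.adicCompletion K] AlgebraicClosure (v.adicCompletion K)) P + P) := by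
  -- (0) the rings `𝒪ⁿʳ ⊆ K_v^nr`, `𝒪_w ⊆ K̄_v` and the structure maps `φ : 𝓞_v → 𝒪ⁿʳ`, `ψ : 𝒪ⁿʳ → 𝒪_w`
  letI instDec : DecidableEq (maxUnramified (v.adicCompletion K)) := fun a b ↦ Classical.propDecidable (a = b)
  haveI := isDiscreteValuationRing_unrIntegers hw
  haveI := henselianLocalRing_unrIntegers hw
  obtain ⟨φ, hφ⟩ := exists_ringHom_adicCompletionIntegers_unrIntegers hw
  obtain ⟨ψ, hψ⟩ := exists_ringHom_unrIntegers_integer (w := w) (v := v) (K := K)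
  have hvR := integers_valuationRing_valuation (Valuation.valuationSubring (Valuation.comap (algebraMap (maxUnramified (v.adicCompletion K)) (AlgebraicClosure (v.adicCompletion K))) w)) (maxUnramified (v.adicCompletion K))
  have hvw : w.Integers w.integer := Valuation.integer.integers w
  have hθ : ∀ a, (((ψ.comp φ) a : w.integer) : AlgebraicClosure (v.adicCompletion K)) =
      algebraMap (v.adicCompletion K) (AlgebraicClosure (v.adicCompletion K)) a := fun a ↦ by
    rw [RingHom.comp_apply, hψ, hφ]
  -- (1) the models `J = N ⊗ 𝒪ⁿʳ` over `𝒪ⁿʳ` and `N ⊗ 𝒪_w`, and the equalities of base changes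
  set J := N.map φ with hJdef
  have hJ3 : J.a₃ = 0 := by rw [hJdef, map_a₃, h3, map_zero]
  have hJ4 : J.a₄ = 0 := by rw [hJdef, map_a₄, h4, map_zero]
  have hJ6 : J.a₆ ∈ maximalIdeal _ := by rw [hJdef, map_a₆]; exact (map_mem_maximalIdeal_iff hw hφ _).mpr h6
  have hJb₂ : IsUnit J.b₂ := by rw [hJdef, map_b₂]; exact hb₂.map φ
  have hJX : J.baseChange (maxUnramified (v.adicCompletion K)) =
      (N.baseChange (v.adicCompletion K)).baseChange (maxUnramified (v.adicCompletion K)) := by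
    have h1 : N.baseChange (maxUnramified (v.adicCompletion K)) = J.baseChange (maxUnramified (v.adicCompletion K)) := by
      change N.map (algebraMap _ _) = (N.map φ).map (algebraMap _ _)
      rw [WeierstrassCurve.map_map]
      congr 1
      refine RingHom.ext fun a ↦ Subtype.ext ?_
      change ((algebraMap (v.adicCompletionIntegers K) (maxUnramified (v.adicCompletion K)) a : (maxUnramified (v.adicCompletion K))) : AlgebraicClosure (v.adicCompletion K)) =
        (((φ a : (Valuation.valuationSubring (Valuation.comap (algebraMap (maxUnramified (v.adicCompletion K)) (AlgebraicClosure (v.adicCompletion K))) w))) : (maxUnramified (v.adicCompletion K))) : (AlgebraicClosure (v.adicCompletion K)))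
      rw [hφ, IsScalarTower.algebraMap_apply (v.adicCompletionIntegers K) (v.adicCompletion K) (maxUnramified (v.adicCompletion K)), IntermediateField.coe_algebraMap_apply]
      rfl
    rw [← h1]
    change N.map (algebraMap _ _) = (N.map (algebraMap _ _)).map (algebraMap _ _)
    rw [WeierstrassCurve.map_map, ← IsScalarTower.algebraMap_eq]
  have hW₀ : (N.map (ψ.comp φ)).baseChange (AlgebraicClosure (v.adicCompletion K)) =
      (N.baseChange (v.adicCompletion K)).baseChange (AlgebraicClosure (v.adicCompletion K)) := by
    change (N.map (ψ.comp φ)).map (algebraMap _ _) = (N.map (algebraMap _ _)).map (algebraMap _ _)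
    rw [WeierstrassCurve.map_map, WeierstrassCurve.map_map]
    congr 1
    exact RingHom.ext fun a ↦ hθ a
  haveI hint : ((N.baseChange (v.adicCompletion K)).baseChange (AlgebraicClosure (v.adicCompletion K))).IsIntegral w.integer :=
    ⟨N.map (ψ.comp φ), hW₀.symm⟩
  -- (2) `F` is an isometry; `E₀` is `F`-stable and closed under addition
  have hFw : ∀ z, w (((absoluteGaloisGroup.toAlgEquiv _ F :
      AlgebraicClosure (v.adicCompletion K) ≃ₐ[v.adicCompletion K] AlgebraicClosure (v.adicCompletion K)) :
      AlgebraicClosure (v.adicCompletion K) →ₐ[v.adicCompletion K] AlgebraicClosure (v.adicCompletion K)) z) = w z :=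
    fun z ↦ spectralValuation_smul hw F z
  have hstab := fun Q ↦ reducesToNonsingular_map_iff_of_forall_eq (w := w) (N.baseChange (v.adicCompletion K)) _ hFw Q
  have hadd : ∀ P₁ P₂ : ((N.baseChange (v.adicCompletion K)).baseChange (AlgebraicClosure (v.adicCompletion K))).toAffine.Point,
      ReducesToNonsingular w (IsLocalRing.residue w.integer) P₁ → ReducesToNonsingular w (IsLocalRing.residue w.integer) P₂ →
        ReducesToNonsingular w (IsLocalRing.residue w.integer) (P₁ + P₂) := by
    intro P₁ P₂ hP₁ hP₂
    have h₁ := (reducesToNonsingular_congrEquiv_iff (w := w) (r := IsLocalRing.residue w.integer) (h := hW₀)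
      (P := (Affine.Point.congrEquiv hW₀).symm P₁)).mp (by rw [AddEquiv.apply_symm_apply]; exact hP₁)
    have h₂ := (reducesToNonsingular_congrEquiv_iff (w := w) (r := IsLocalRing.residue w.integer) (h := hW₀)
      (P := (Affine.Point.congrEquiv hW₀).symm P₂)).mp (by rw [AddEquiv.apply_symm_apply]; exact hP₂)
    rw [reducesToNonsingular_iff_hasNonsingularReduction] at h₁ h₂
    have h := h₁.add hvw h₂
    rw [← map_add, ← reducesToNonsingular_iff_hasNonsingularReduction] at h
    have h' := (reducesToNonsingular_congrEquiv_iff (w := w) (r := IsLocalRing.residue w.integer) (h := hW₀)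
      (P := _)).mpr h
    rwa [AddEquiv.apply_symm_apply] at h'
  -- (3) the good cases
  rcases P with _ | ⟨x, y, hxy⟩
  · rw [show (Affine.Point.zero : ((N.baseChange (v.adicCompletion K)).baseChange (AlgebraicClosure (v.adicCompletion K))).toAffine.Point) = 0 from rfl,
      map_zero, add_zero]
    exact reducesToNonsingular_zero
  by_cases hgood : ReducesToNonsingular w (IsLocalRing.residue w.integer)
      (Affine.Point.some x y hxy : ((N.baseChange (v.adicCompletion K)).baseChange (AlgebraicClosure (v.adicCompletion K))).toAffine.Point)
  · exact hadd _ _ ((hstab _).mpr hgood) hgood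
  -- (4) the bad case: `|x| ≤ 1`; the coordinates lie in `K_v^nr`, indeed in `𝒪ⁿʳ`
  have hx1 : w x ≤ 1 := not_lt.mp fun hlt ↦ hgood (reducesToNonsingular_of_one_lt hlt)
  have hy1 : w y ≤ 1 := val_y_le_one (w := w) (V := (N.baseChange (v.adicCompletion K)).baseChange (AlgebraicClosure (v.adicCompletion K))) hxy.1 hx1
  have hxnr : x ∈ maxUnramified (v.adicCompletion K) := (mem_maxUnramified_iff_forall_inertia hw h𝔐).mpr fun τ hτ ↦ by
    have := hP τ hτ
    rw [Affine.Point.map_some, Affine.Point.some.injEq] at this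
    exact this.1
  have hynr : y ∈ maxUnramified (v.adicCompletion K) := (mem_maxUnramified_iff_forall_inertia hw h𝔐).mpr fun τ hτ ↦ by
    have := hP τ hτ
    rw [Affine.Point.map_some, Affine.Point.some.injEq] at this
    exact this.2
  have hale : (⟨x, hxnr⟩ : maxUnramified (v.adicCompletion K)) ∈ (Valuation.valuationSubring (Valuation.comap (algebraMap (maxUnramified (v.adicCompletion K)) (AlgebraicClosure (v.adicCompletion K))) w)) := by
    rw [Valuation.mem_valuationSubring_iff, comap_maxUnramified_apply]; exact hx1
  have hble : (⟨y, hynr⟩ : maxUnramified (v.adicCompletion K)) ∈ (Valuation.valuationSubring (Valuation.comap (algebraMap (maxUnramified (v.adicCompletion K)) (AlgebraicClosure (v.adicCompletion K))) w)) := by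
    rw [Valuation.mem_valuationSubring_iff, comap_maxUnramified_apply]; exact hy1
  set a : (Valuation.valuationSubring (Valuation.comap (algebraMap (maxUnramified (v.adicCompletion K)) (AlgebraicClosure (v.adicCompletion K))) w)) := ⟨⟨x, hxnr⟩, hale⟩ with hadef
  set b : (Valuation.valuationSubring (Valuation.comap (algebraMap (maxUnramified (v.adicCompletion K)) (AlgebraicClosure (v.adicCompletion K))) w)) := ⟨⟨y, hynr⟩, hble⟩ with hbdef
  have ha : (((a : (Valuation.valuationSubring (Valuation.comap (algebraMap (maxUnramified (v.adicCompletion K)) (AlgebraicClosure (v.adicCompletion K))) w))) : maxUnramified (v.adicCompletion K)) : AlgebraicClosure (v.adicCompletion K)) = x := rfl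
  have hb : (((b : (Valuation.valuationSubring (Valuation.comap (algebraMap (maxUnramified (v.adicCompletion K)) (AlgebraicClosure (v.adicCompletion K))) w))) : maxUnramified (v.adicCompletion K)) : AlgebraicClosure (v.adicCompletion K)) = y := rfl
  -- the Frobenius on `𝒪ⁿʳ`
  obtain ⟨σ, hσ⟩ := exists_ringEquiv_unrIntegers_smul hw F
  have hσφ : ∀ c, σ (φ c) = φ c := fun c ↦ ringEquiv_unrIntegers_map_eq hσ hφ c
  -- the points `(a, b)` and `(σ a, σ b)` of `J(K_v^nr)`
  have hinjι : Function.Injective (IsScalarTower.toAlgHom (v.adicCompletion K) (maxUnramified (v.adicCompletion K)) (AlgebraicClosure (v.adicCompletion K))) :=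
    fun c d hcd ↦ Subtype.ext hcd
  have hQ : (J.baseChange (maxUnramified (v.adicCompletion K))).toAffine.Nonsingular
      (algebraMap _ (maxUnramified (v.adicCompletion K)) a) (algebraMap _ (maxUnramified (v.adicCompletion K)) b) := by
    rw [hJX]
    exact (Affine.baseChange_nonsingular (W := N.baseChange (v.adicCompletion K))
      (f := IsScalarTower.toAlgHom (v.adicCompletion K) (maxUnramified (v.adicCompletion K)) (AlgebraicClosure (v.adicCompletion K)))
      hinjι _ _).mp hxy
  have hFxy : ((N.baseChange (v.adicCompletion K)).baseChange (AlgebraicClosure (v.adicCompletion K))).toAffine.Nonsingular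
      (F • x) (F • y) :=
    (Affine.baseChange_nonsingular (W := N.baseChange (v.adicCompletion K))
      (f := ((absoluteGaloisGroup.toAlgEquiv _ F :
        AlgebraicClosure (v.adicCompletion K) ≃ₐ[v.adicCompletion K] AlgebraicClosure (v.adicCompletion K)) :
        AlgebraicClosure (v.adicCompletion K) →ₐ[v.adicCompletion K] AlgebraicClosure (v.adicCompletion K)))
      (AlgEquiv.injective _) x y).mpr hxy
  have hσa : (((σ a : (Valuation.valuationSubring (Valuation.comap (algebraMap (maxUnramified (v.adicCompletion K)) (AlgebraicClosure (v.adicCompletion K))) w))) : maxUnramified (v.adicCompletion K)) : AlgebraicClosure (v.adicCompletion K)) = F • x := by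
    rw [hσ]
  have hσb : (((σ b : (Valuation.valuationSubring (Valuation.comap (algebraMap (maxUnramified (v.adicCompletion K)) (AlgebraicClosure (v.adicCompletion K))) w))) : maxUnramified (v.adicCompletion K)) : AlgebraicClosure (v.adicCompletion K)) = F • y := by
    rw [hσ]
  have hQ' : (J.baseChange (maxUnramified (v.adicCompletion K))).toAffine.Nonsingular
      (algebraMap _ (maxUnramified (v.adicCompletion K)) (σ a)) (algebraMap _ (maxUnramified (v.adicCompletion K)) (σ b)) := by
    rw [hJX]
    refine (Affine.baseChange_nonsingular (W := N.baseChange (v.adicCompletion K))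
      (f := IsScalarTower.toAlgHom (v.adicCompletion K) (maxUnramified (v.adicCompletion K)) (AlgebraicClosure (v.adicCompletion K)))
      hinjι _ _).mp ?_
    have ex : (IsScalarTower.toAlgHom (v.adicCompletion K) (maxUnramified (v.adicCompletion K)) (AlgebraicClosure (v.adicCompletion K)))
        (algebraMap _ (maxUnramified (v.adicCompletion K)) (σ a)) = F • x := hσa
    have ey : (IsScalarTower.toAlgHom (v.adicCompletion K) (maxUnramified (v.adicCompletion K)) (AlgebraicClosure (v.adicCompletion K)))
        (algebraMap _ (maxUnramified (v.adicCompletion K)) (σ b)) = F • y := hσb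
    rw [ex, ey]
    exact hFxy
  -- the images in `N(K̄_v)` of these two points are `P` and `F P`
  have himg : Affine.Point.map (W' := N.baseChange (v.adicCompletion K))
        (IsScalarTower.toAlgHom (v.adicCompletion K) (maxUnramified (v.adicCompletion K)) (AlgebraicClosure (v.adicCompletion K)))
        (Affine.Point.congrEquiv hJX (Affine.Point.some _ _ hQ)) = Affine.Point.some x y hxy := by
    rw [Affine.Point.congrEquiv_some, Affine.Point.map_some]
    exact point_some_congr ha hb
  have himg' : Affine.Point.map (W' := N.baseChange (v.adicCompletion K))
        (IsScalarTower.toAlgHom (v.adicCompletion K) (maxUnramified (v.adicCompletion K)) (AlgebraicClosure (v.adicCompletion K)))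
        (Affine.Point.congrEquiv hJX (Affine.Point.some _ _ hQ')) =
      Affine.Point.map ((absoluteGaloisGroup.toAlgEquiv _ F :
        AlgebraicClosure (v.adicCompletion K) ≃ₐ[v.adicCompletion K] AlgebraicClosure (v.adicCompletion K)) :
        AlgebraicClosure (v.adicCompletion K) →ₐ[v.adicCompletion K] AlgebraicClosure (v.adicCompletion K))
        (Affine.Point.some x y hxy) := by
    rw [Affine.Point.congrEquiv_some, Affine.Point.map_some, Affine.Point.map_some]
    exact point_some_congr hσa hσb
  -- `(a, b)` is a bad point of `J`: `a ∈ 𝔪ⁿʳ`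
  have hbad : ¬ J.HasNonsingularReduction (Affine.Point.some _ _ hQ) := fun hgood' ↦ hgood (by
    have := reducesToNonsingular_map_congrEquiv_of_hasNonsingularReduction J (N.baseChange (v.adicCompletion K)) hJX hgood'
    rwa [himg] at this)
  obtain ⟨a', b', hQ₁, hPeq, ha', -⟩ := exists_eq_some_of_not_hasNonsingularReduction J
    (by rw [hJ3]; exact zero_mem _) (by rw [hJ4]; exact zero_mem _) hJ6 hbad
  have haa' : a = a' := by
    have := (Affine.Point.some.injEq _ _ _ _ _ _).mp hPeq
    exact IsFractionRing.injective _ _ this.1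
  have hamem : a ∈ maximalIdeal _ := haa' ▸ ha'
  -- the tangent slopes over `𝒪ⁿʳ`, swapped by `σ`
  obtain ⟨ρ, ρ', hs, hp, hδ⟩ := exists_slopes_unrIntegers hw J hJ3 hJ4 hJ6 hJb₂
  have hσ1 : σ J.a₁ = J.a₁ := by rw [hJdef, map_a₁]; exact hσφ _
  have hσ2 : σ J.a₂ = J.a₂ := by rw [hJdef, map_a₂]; exact hσφ _
  have hσ6 : σ J.a₆ = J.a₆ := by rw [hJdef, map_a₆]; exact hσφ _
  -- no `σ`-fixed element of `𝒪ⁿʳ` reduces to `ρ̄`: the residue of a fixed element lies in `k_v`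
  obtain ⟨j, hj, hjinj, hjfix⟩ := exists_residueFieldMap_adicCompletionIntegers (v := v) hw
  have hρ : ρ ^ 2 + J.a₁ * ρ - J.a₂ = 0 := by
    have e : ρ' = -J.a₁ - ρ := by linear_combination hs
    rw [e] at hp
    linear_combination (-1 : (Valuation.valuationSubring (Valuation.comap (algebraMap (maxUnramified (v.adicCompletion K)) (AlgebraicClosure (v.adicCompletion K))) w))) * hp
  have hfix : ∀ r : (Valuation.valuationSubring (Valuation.comap (algebraMap (maxUnramified (v.adicCompletion K)) (AlgebraicClosure (v.adicCompletion K))) w)),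
      σ r = r → IsUnit (r - ρ) := by
    intro r hr
    by_contra hru
    have hm : r - ρ ∈ maximalIdeal _ := (IsLocalRing.mem_maximalIdeal _).mpr (mem_nonunits_iff.mpr hru)
    -- `ψ r ≡ ψ ρ (mod 𝔪_w)`
    have hres : IsLocalRing.residue w.integer (ψ r) = IsLocalRing.residue w.integer (ψ ρ) := by
      rw [← sub_eq_zero, ← map_sub, ← map_sub, IsLocalRing.residue_eq_zero_iff]
      exact (map_mem_maximalIdeal_integer_iff hψ _).mpr hm
    -- `F` fixes `ψ r`, so its residue is fixed by the `q`-power map, hence comes from `k_v`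
    have hFr : F • ((ψ r : w.integer) : AlgebraicClosure (v.adicCompletion K)) = (ψ r : w.integer) := by
      rw [hψ, ← hσ, hr]
    have hFr1 : w (F • ((ψ r : w.integer) : AlgebraicClosure (v.adicCompletion K))) ≤ 1 := by
      rw [hFr]; exact (ψ r).2
    have hpow := residue_smul_eq_pow_residueCard_of_isArithFrobAt v hw h𝔐 hF (ψ r) hFr1
    have heq : (⟨F • ((ψ r : w.integer) : AlgebraicClosure (v.adicCompletion K)), hFr1⟩ : w.integer) = ψ r :=
      Subtype.ext hFr
    rw [heq] at hpow
    obtain ⟨t, ht⟩ := hjfix _ hpow.symm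
    -- `t` is a `k_v`-root of the tangent form
    apply hani t
    apply hjinj
    have hja : ∀ c : v.adicCompletionIntegers K,
        j (residue (v.adicCompletionIntegers K) c) = IsLocalRing.residue w.integer (ψ (φ c)) := by
      intro c
      have hle : w (algebraMap (v.adicCompletion K) (AlgebraicClosure (v.adicCompletion K))
          (algebraMap (v.adicCompletionIntegers K) (v.adicCompletion K) c)) ≤ 1 :=
        (spectralValuation_algebraMap_le_one_iff hw _).mpr c.2
      rw [hj c hle]
      congr 1
      exact Subtype.ext (by
        change algebraMap (v.adicCompletion K) (AlgebraicClosure (v.adicCompletion K))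
            (algebraMap (v.adicCompletionIntegers K) (v.adicCompletion K) c) =
          (((ψ.comp φ) c : w.integer) : AlgebraicClosure (v.adicCompletion K))
        rw [hθ c]
        rfl)
    rw [map_sub, map_add, map_mul, map_pow, hja, hja, ht, hres, map_zero, ← map_pow, ← map_mul, ← map_add,
      ← map_sub, ← map_pow, ← map_mul, ← map_add, ← map_sub]
    have e : ρ ^ 2 + φ N.a₁ * ρ - φ N.a₂ = 0 := by
      rw [hJdef, map_a₁, map_a₂] at hρ; exact hρ
    rw [e, map_zero, map_zero]
  have hσρ : σ ρ = ρ' := by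
    -- `σ ρ` is a root of the tangent form, and `σ ρ ≠ ρ`
    have hroot : (σ ρ - ρ) * (σ ρ - ρ') = 0 := by
      have e1 : (σ ρ - ρ) * (σ ρ - ρ') = σ ρ ^ 2 + J.a₁ * σ ρ - J.a₂ := by
        linear_combination (-(σ ρ)) * hs + hp
      have e2 : σ ρ ^ 2 + J.a₁ * σ ρ - J.a₂ = σ (ρ ^ 2 + J.a₁ * ρ - J.a₂) := by
        rw [map_sub, map_add, map_pow, map_mul, hσ1, hσ2]
      rw [e1, e2, hρ, map_zero]
    rcases mul_eq_zero.mp hroot with h0 | h0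
    · exfalso
      have hu := hfix ρ (sub_eq_zero.mp h0)
      rw [sub_self] at hu
      exact not_isUnit_zero hu
    · exact sub_eq_zero.mp h0
  have hσρ' : σ ρ' = ρ := by
    have e : ρ' = -J.a₁ - ρ := by linear_combination hs
    rw [e, map_sub, map_neg, hσ1, hσρ]
    linear_combination (-1 : (Valuation.valuationSubring (Valuation.comap (algebraMap (maxUnramified (v.adicCompletion K)) (AlgebraicClosure (v.adicCompletion K))) w))) * hs
  -- (5) the core: `(a, b) + (σ a, σ b) ∈ J₀(K_v^nr)`, pushed into `N(K̄_v)`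
  have hcore := hasNonsingularReduction_add_conj (K := maxUnramified (v.adicCompletion K)) J hJ3 hJ4 hJ6 hs hp hδ σ
    hσ1 hσ2 hσ6 hσρ hσρ' hfix hamem hQ hQ'
  have hsum := reducesToNonsingular_map_congrEquiv_of_hasNonsingularReduction J (N.baseChange (v.adicCompletion K)) hJX hcore
  rw [map_add, map_add, himg, himg', add_comm] at hsum
  exact hsum


end Summit.BirchSwinnertonDyer.BirchSwinnertonDyer.Theorems.GenusKolyvagin.NonsplitSign

end
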